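import Mathlib
import HarnessLib
import Summits.HubbardSuperconductivity.HubbardSuperconductivity.Theorems.KLProgrammeKLRegimeEngineTwoLegStepV17FBareFrame
import Summits.HubbardSuperconductivity.HubbardSuperconductivity.Theorems.KLProgrammeKLRegimeEngineScaleZeroAlphaWX5
import Summits.HubbardSuperconductivity.HubbardSuperconductivity.Theorems.KLProgrammeKLRegimeEngineTwoLegStepV17FDoor

/-!
# K3 gen-7F engine-flow child `KLRegimeEngineV17F` (stmt-HubbardSuperconductivity-20368), stub (M) at the bare frame: conjunct (B)
# `TwoLegSlopes … (klFlowFrameU … 0) 0` — (E3d) field strength and (E3e) normal slope — with the covariance size DISCHARGED BY NAME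

Cell gate-hubbard-kl, seat p1b (g8), (M) owner.  The registered (M) text (engine-flow template l.94) receives stub 6-F's reading jets (row (A)) and must
produce `TwoLegStepV17F … 0 = TwoLegReadJetsF ∧ TwoLegSlopes … K₀ 0 ∧ TwoLegVolumeRateF`; row (C) is the VL lanes'.  This file closes row (B) at the
bare frame from ONE real number `a₁` majorising p3 g8's definite `gridLabelWt`-weighted decay constant of the bare scale-`0` grid covariance
(`rowSum/colSum_scaleZero_gridLabelWt_le_X5`, …ScaleZeroAlphaWX5, read at `K = 0`, `Nsc = 0`):
* `bareAlphaRow_le` / `bareAlphaCol_le` — the `k = 1` covariance hypotheses of `…TwoLegBareFrameJets` in BOTH weight currencies (`gridLabelWt` and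
  `diamWeight (1+s)¹`) from `hA : A₁(R,U) ≤ a₁`;
* **`twoLegSlopes_bareFrame`** — `TwoLegSlopes L M R β U μ (klFlowFrameU L M β U μ 0) 0` from the regime binders, `hA`, the two smallnesses
  `16e⁹κ₀²·klScaleZeroA0·|U| ≤ 1/4`, `16e⁹κ₀²·a₁·|U| ≤ 1/2`, and the two fits `2^{10}e¹⁸κ₀⁴a₁U² ≤ cz|U|`,
  `2^{11}e¹⁸κ₀⁴a₁U² + (4/3)Gfr₁U² ≤ cz|U|·cDtmin(−1.2)(−0.05)/2` (`κ₀² = 2(7+1606732)`) — via p1b's `abs_klFieldStrength_frameZero_sub_one_le` /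
  `twoLeg_momentumSizes_frameZero` (k = 1) and r2d-p1's `twoLegSlopes_flowFrame_of_sepTubeGradient`.
What is left for row (B) of (M): the choice `a₁` (e.g. p4 g9's `klE4Abar R` once `A₁ ≤ klE4Abar` is recorded) and the four displayed numeral conditions
against the registered thresholds `klEngU₀6` / `R.cz` (risk-register item 1: explicit `U₀`).  Proofs only; no definitions.
References: BGM 2006 §3 (3.2)–(3.3), (2.40) [cite: BenfattoGiulianiMastropietro2006].
-/

noncomputable section

namespace Summit.HubbardSuperconductivity.HubbardSuperconductivity.Theorems.EngineV8

set_option linter.dupNamespace false -- summit = problem name (single-conjunct summit), D-0017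

open Real Finset Literature.MathematicalPhysics.QuantumLattice Literature.Probability.LatticeModels
open Literature.MathematicalPhysics.QuantumLattice.FermiRG Literature.MathematicalPhysics.QuantumLattice.BandSectorCounting
open Literature.Probability.LatticeModels.BattleFederbush GrassmannAlgebra
open Summit.HubbardSuperconductivity.HubbardSuperconductivity.Theorems.KLProgrammeLegKernels
open Summit.HubbardSuperconductivity.HubbardSuperconductivity.Theorems.DispersionFlow
open Summit.HubbardSuperconductivity.HubbardSuperconductivity.Theorems.PerturbedFermiCurve
open Summit.HubbardSuperconductivity.HubbardSuperconductivity.Theorems.KLRegimeSplit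
open Summit.HubbardSuperconductivity.HubbardSuperconductivity.Theorems.TwoLegFourier

section BareSlopes

variable {L M : ℕ} [NeZero L] [NeZero M] {R : RenConsts} {μ U β c a₁ : ℝ}

/-- **The bare-frame `gridLabelWt`-weighted ROW sums from ONE number `a₁ ≥ A₁(R,U)`** (p3 g8's definite constant at `K = 0`, `Nsc = 0`). -/
theorem bareAlphaRow_le (hRW : R.WF) (hμ : μ ∈ klWindowC) (hU1 : |U| ≤ 1) (hβ : klBetaMin ≤ β) (hL : klEngL₃ β U ≤ L) (hM : klEngM₃ β U L ≤ M)
    (hA : klScaleZeroA0 + uvTimeMomentConst klE0 7 32 +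
          2 * (uvSpaceMomentConst klE0 1 (uvPieceSq klE0 (uvBaseQ klCutoffX5 klE0 4) (uvBaseQ' klCutoffX5 klE0 4)) +
            (1 / 4 * Real.sqrt (216 * (1 / klE0 + 1 / 2)) *
                ∑ e : Fin 2 × Fin 2, (uvLinV klE0 (1 + (e.1 : ℕ) + (e.2 : ℕ)) *
                    (klCutoffX5 * ((1 + ((e.1 : ℕ) + (e.2 : ℕ)) + 2).factorial : ℝ) * (4 / klE0) ^ (1 + ((e.1 : ℕ) + (e.2 : ℕ)) + 1)) +
                  uvLinD klE0 (1 + (e.1 : ℕ) + (e.2 : ℕ)) *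
                    (klCutoffX5 * ((1 + ((e.1 : ℕ) + (e.2 : ℕ)) + 3).factorial : ℝ) * (4 / klE0) ^ (1 + ((e.1 : ℕ) + (e.2 : ℕ)) + 2)))) *
              (4608 * (1 + R.Gfr 0 + R.Gfr 1 + R.Gfr 2 + R.Gfr 3) ^ 4 * ((((0 : ℕ) : ℝ) + 1) * U ^ 2 + 2 * |U|))) ≤ a₁)
    (X : GridLeg (GridPoint L (2 * (2 * M)))) :
    ∑ Y, ‖((hubbardGridSub L M β (2 * (2 * M))).transpose * hubbardCovAboveCT L M β μ 0 0 klE0 *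
        hubbardGridSub L M β (2 * (2 * M))) X Y‖ * gridLabelWt L (2 * (2 * M)) β {gridLegPos X, gridLegPos Y} ≤
      a₁ * ((2 * (2 * M) : ℕ) : ℝ) / β := by
  have hβ0 : 0 < β := lt_of_lt_of_le (by norm_num [klBetaMin]) hβ
  have hN : (0 : ℝ) ≤ ((2 * (2 * M) : ℕ) : ℝ) / β := by positivity
  have h := rowSum_scaleZero_gridLabelWt_le_X5 (L := L) (M := M) (klFrameOK_zeroC hRW U 0 hμ) hRW hU1 hβ hL hM X
  refine h.trans ?_
  rw [show a₁ * ((2 * (2 * M) : ℕ) : ℝ) / β = ((2 * (2 * M) : ℕ) : ℝ) / β * a₁ by ring]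
  exact mul_le_mul_of_nonneg_left hA hN

/-- **The bare-frame `gridLabelWt`-weighted COLUMN sums from `a₁ ≥ A₁(R,U)`.** -/
theorem bareAlphaCol_le (hRW : R.WF) (hμ : μ ∈ klWindowC) (hU1 : |U| ≤ 1) (hβ : klBetaMin ≤ β) (hL : klEngL₃ β U ≤ L) (hM : klEngM₃ β U L ≤ M)
    (hA : klScaleZeroA0 + uvTimeMomentConst klE0 7 32 +
          2 * (uvSpaceMomentConst klE0 1 (uvPieceSq klE0 (uvBaseQ klCutoffX5 klE0 4) (uvBaseQ' klCutoffX5 klE0 4)) +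
            (1 / 4 * Real.sqrt (216 * (1 / klE0 + 1 / 2)) *
                ∑ e : Fin 2 × Fin 2, (uvLinV klE0 (1 + (e.1 : ℕ) + (e.2 : ℕ)) *
                    (klCutoffX5 * ((1 + ((e.1 : ℕ) + (e.2 : ℕ)) + 2).factorial : ℝ) * (4 / klE0) ^ (1 + ((e.1 : ℕ) + (e.2 : ℕ)) + 1)) +
                  uvLinD klE0 (1 + (e.1 : ℕ) + (e.2 : ℕ)) *
                    (klCutoffX5 * ((1 + ((e.1 : ℕ) + (e.2 : ℕ)) + 3).factorial : ℝ) * (4 / klE0) ^ (1 + ((e.1 : ℕ) + (e.2 : ℕ)) + 2)))) *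
              (4608 * (1 + R.Gfr 0 + R.Gfr 1 + R.Gfr 2 + R.Gfr 3) ^ 4 * ((((0 : ℕ) : ℝ) + 1) * U ^ 2 + 2 * |U|))) ≤ a₁)
    (Y : GridLeg (GridPoint L (2 * (2 * M)))) :
    ∑ X, ‖((hubbardGridSub L M β (2 * (2 * M))).transpose * hubbardCovAboveCT L M β μ 0 0 klE0 *
        hubbardGridSub L M β (2 * (2 * M))) X Y‖ * gridLabelWt L (2 * (2 * M)) β {gridLegPos X, gridLegPos Y} ≤
      a₁ * ((2 * (2 * M) : ℕ) : ℝ) / β := by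
  have hβ0 : 0 < β := lt_of_lt_of_le (by norm_num [klBetaMin]) hβ
  have hN : (0 : ℝ) ≤ ((2 * (2 * M) : ℕ) : ℝ) / β := by positivity
  have h := colSum_scaleZero_gridLabelWt_le_X5 (L := L) (M := M) (klFrameOK_zeroC hRW U 0 hμ) hRW hU1 hβ hL hM Y
  refine h.trans ?_
  rw [show a₁ * ((2 * (2 * M) : ℕ) : ℝ) / β = ((2 * (2 * M) : ℕ) : ℝ) / β * a₁ by ring]
  exact mul_le_mul_of_nonneg_left hA hN

/-- **(B) AT THE BARE FRAME — `TwoLegSlopes L M R β U μ (klFlowFrameU L M β U μ 0) 0`** (the (E3d) field strength within `cz|U|` of `1` on the scale-`0`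
shell and the (E3e) normal slope of the scale-`0` reading): from the regime binders, ONE number `a₁ ≥ A₁(R,U)` (p3's definite weighted decay constant of the
bare scale-`0` grid covariance), the smallnesses `16e⁹κ₀²·klScaleZeroA0·|U| ≤ 1/4`, `16e⁹κ₀²·a₁·|U| ≤ 1/2`, and the fits
`2^{10}e¹⁸κ₀⁴·a₁·U² ≤ cz|U|`, `2^{11}e¹⁸κ₀⁴·a₁·U² + (4/3)Gfr₁U² ≤ cz|U|·cDtmin(−1.2)(−0.05)/2`. -/
theorem twoLegSlopes_bareFrame (hRW : R.WF) (hc : 0 < c) (hcle : c ≤ klCurveC3 R) (hμ : μ ∈ klWindowC) (hU : 0 < U)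
    (hUle : U ≤ klCurveU0 R) (hU1 : U ≤ 1) (hβ : klBetaMin ≤ β) (hβc : β ≤ Real.exp (c / U ^ 2)) (hL : klEngL₃ β U ≤ L)
    (hM : klEngM₃ β U L ≤ M) (ha : 0 < a₁)
    (hA : klScaleZeroA0 + uvTimeMomentConst klE0 7 32 +
          2 * (uvSpaceMomentConst klE0 1 (uvPieceSq klE0 (uvBaseQ klCutoffX5 klE0 4) (uvBaseQ' klCutoffX5 klE0 4)) +
            (1 / 4 * Real.sqrt (216 * (1 / klE0 + 1 / 2)) *
                ∑ e : Fin 2 × Fin 2, (uvLinV klE0 (1 + (e.1 : ℕ) + (e.2 : ℕ)) *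
                    (klCutoffX5 * ((1 + ((e.1 : ℕ) + (e.2 : ℕ)) + 2).factorial : ℝ) * (4 / klE0) ^ (1 + ((e.1 : ℕ) + (e.2 : ℕ)) + 1)) +
                  uvLinD klE0 (1 + (e.1 : ℕ) + (e.2 : ℕ)) *
                    (klCutoffX5 * ((1 + ((e.1 : ℕ) + (e.2 : ℕ)) + 3).factorial : ℝ) * (4 / klE0) ^ (1 + ((e.1 : ℕ) + (e.2 : ℕ)) + 2)))) *
              (4608 * (1 + R.Gfr 0 + R.Gfr 1 + R.Gfr 2 + R.Gfr 3) ^ 4 * ((((0 : ℕ) : ℝ) + 1) * U ^ 2 + 2 * |U|))) ≤ a₁)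
    (hsmall₀ : 16 * Real.exp 1 ^ 9 * Real.sqrt (2 * (7 + 1606732)) ^ 2 * klScaleZeroA0 * |U| ≤ 1 / 4)
    (hsmall₁ : 16 * Real.exp 1 ^ 9 * Real.sqrt (2 * (7 + 1606732)) ^ 2 * a₁ * |U| ≤ 1 / 2)
    (hfitz : (2 : ℝ) ^ 10 * Real.exp 1 ^ 18 * Real.sqrt (2 * (7 + 1606732)) ^ 4 * a₁ * U ^ 2 ≤ R.cz * |U|)
    (hfit1 : (2 : ℝ) ^ 11 * Real.exp 1 ^ 18 * Real.sqrt (2 * (7 + 1606732)) ^ 4 * a₁ * U ^ 2 + 4 / 3 * R.Gfr 1 * U ^ 2 ≤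
      R.cz * |U| * (cDtmin (-1.2) (-0.05) / 2)) :
    TwoLegSlopes L M R β U μ (klFlowFrameU L M β U μ 0) 0 := by
  have hR : ∀ j, 0 ≤ R.Gfr j := hRW.2.2
  have hU1' : |U| ≤ 1 := by rw [abs_of_pos hU]; exact hU1
  have hrow1 := bareAlphaRow_le (L := L) (M := M) hRW hμ hU1' hβ hL hM hA
  have hcol1 := bareAlphaCol_le (L := L) (M := M) hRW hμ hU1' hβ hL hM hA
  -- (E3d): the field strength at every torus momentum
  have hz : ∀ k ∈ klShell L μ (klFlowFrameU L M β U μ 0) 0, |klFieldStrength L M β U μ (klFlowFrameU L M β U μ 0) 0 k - 1| ≤ R.cz * |U| := by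
    intro k _
    rw [klFlowFrameU_zero]
    exact (abs_klFieldStrength_frameZero_sub_one_le (L := L) (M := M) hRW 0 hμ hU hβ hL hM ha hrow1 hcol1 hsmall₁ k).trans hfitz
  -- (E3e): the global gradient of `I_L[σ₀]` (order 1 of the all-order bridge, in the `(1+diam)¹` currency)
  have hrowd : ∀ k, 1 ≤ k → k ≤ 1 → ∀ X, ∑ Y, ‖((hubbardGridSub L M β (2 * (2 * M))).transpose * hubbardCovAboveCT L M β μ 0 0 klE0 *
      hubbardGridSub L M β (2 * (2 * M))) X Y‖ * diamWeight (fun s => (1 + 1 * s) ^ k) (gridLabelDist L (2 * (2 * M)) β) {gridLegPos X, gridLegPos Y} ≤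
        (fun _ : ℕ => a₁) k * ((2 * (2 * M) : ℕ) : ℝ) / β := by
    intro k hk1 hk1' X
    obtain rfl : k = 1 := le_antisymm hk1' hk1
    simpa only [← gridLabelWt_eq_polyWt_one] using hrow1 X
  have hcold : ∀ k, 1 ≤ k → k ≤ 1 → ∀ Y, ∑ X, ‖((hubbardGridSub L M β (2 * (2 * M))).transpose * hubbardCovAboveCT L M β μ 0 0 klE0 *
      hubbardGridSub L M β (2 * (2 * M))) X Y‖ * diamWeight (fun s => (1 + 1 * s) ^ k) (gridLabelDist L (2 * (2 * M)) β) {gridLegPos X, gridLegPos Y} ≤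
        (fun _ : ℕ => a₁) k * ((2 * (2 * M) : ℕ) : ℝ) / β := by
    intro k hk1 hk1' Y
    obtain rfl : k = 1 := le_antisymm hk1' hk1
    simpa only [← gridLabelWt_eq_polyWt_one] using hcol1 Y
  obtain ⟨-, hk⟩ := twoLeg_momentumSizes_frameZero (L := L) (M := M) hRW 0 hμ hU hβ hL hM hsmall₀ 1 (a := fun _ => a₁) (fun _ _ _ => ha)
    hrowd hcold (fun _ _ _ => hsmall₁)
  have hm₁' : ∀ q : Momentum, |frameLevel μ (klFlowFrameU L M β U μ 0) q| ≤ klScale klE0 0 →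
      ‖fderiv ℝ (evalM (symInterp L (fun p => klLocSelfEnergyRe L M β U μ (klFlowFrameU L M β U μ 0) 0 p -
        (klFlowFrameU L M β U μ 0).eval (latticeMomentum L p)))) q‖ ≤
        (2 : ℝ) ^ 11 * Real.exp 1 ^ 18 * Real.sqrt (2 * (7 + 1606732)) ^ 4 * a₁ * U ^ 2 := fun q _ => by
    have h := hk 1 le_rfl le_rfl q
    rw [norm_iteratedFDeriv_one] at h
    simpa only [klFlowFrameU_zero, TrigPolyC4v.eval_zero, sub_zero] using h
  have hK : FrameOK R U (nScales β) μ (klFlowFrameU L M β U μ 0) := by rw [klFlowFrameU_zero]; exact klFrameOK_zeroC hRW U (nScales β) hμ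
  exact twoLegSlopes_flowFrame_of_sepTubeGradient hR hc hcle hU hUle hβ hβc hμ (Nat.zero_le _) hK hL hz hm₁' hfit1

end BareSlopes

end Summit.HubbardSuperconductivity.HubbardSuperconductivity.Theorems.EngineV8

end
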